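import Summits.Ventures.HodgeRepro2.T6InterfaceToyN
import Summits.Ventures.HodgeRepro2.CyclotomicSeven

/-!
# T6InterfaceK7 — the M1 hypothesis set instantiated over `ℚ(ζ₇)`

README §10.5(ii)(c),(d) for M1 (`theoremA_of_N [IsGalois ℚ K] [NumberField.IsCMField K] (D : TransferShadow F)
(hN : Hyp.PeriodN D)`, TARGET-T6.md §5): EVERY binder is instantiated simultaneously on the Tier-5 field
`K7 := CyclotomicField 7 ℚ` (p1's `CyclotomicSeven`, p394053): `K7` is Galois and CM (`isGalois_K7`,
`isCMField_K7`), sextic (`finrank_K7`), and carries a parity tetrahedron (`exists_isWeilFace_K7`) — so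
`faceSettingK7 : FaceSetting K7` exists (the carrier `FaceSetting K` is inhabited, (c)) — and on that face
the N-shadow of `T6InterfaceToyN` satisfies the displayed (N) (`exists_periodN_of_face`, (d)).
`hypotheses_satisfiable_K7` packages the four. Rebuilt by t6-lead g2 from the l. 4644 shape.
§8(d): uses an L-value-free non-vanishing device: NO.
-/

namespace Summit.Ventures.HodgeRepro2.T6.K7Witness

open Summit.Ventures.HodgeRepro2.CyclotomicSeven

/-- The parity tetrahedron of `ℚ(ζ₇)` (p1's `exists_isWeilFace_K7`) as a face setting. -/
noncomputable def faceSettingK7 : FaceSetting K7 where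
  deg6 := finrank_K7
  T := parityTetrahedron K7 (Classical.choose exists_isWeilFace_K7)
  face := Classical.choose_spec exists_isWeilFace_K7

/-- The carrier `FaceSetting K` of the M1 theorem is inhabited (README §10.5(ii)(c)). -/
theorem nonempty_faceSetting_K7 : Nonempty (FaceSetting K7) := ⟨faceSettingK7⟩

/-- THE M1 HYPOTHESIS SET IS SATISFIABLE (README §10.5(ii)(c),(d)): over `K7 = ℚ(ζ₇)` the class binders
`IsGalois ℚ K7`, `NumberField.IsCMField K7` hold, a face setting exists, and on it a transfer shadow
satisfies the displayed hypothesis (N). -/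
theorem hypotheses_satisfiable_K7 :
    IsGalois ℚ K7 ∧ NumberField.IsCMField K7 ∧
      ∃ (F : FaceSetting K7) (D : TransferShadow F), Hyp.PeriodN D :=
  ⟨isGalois_K7, isCMField_K7, faceSettingK7, ToyN.exists_periodN_of_face K7 faceSettingK7⟩

end Summit.Ventures.HodgeRepro2.T6.K7Witness
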